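import Mathlib
import HarnessLib
import Literature.MathematicalPhysics.StatisticalMechanics.FluctuationKernelComparisonConnTorusFRD

/-!
# [ABKM19] Lemma 8.4 (`ℓ = 1`), volume-uniform, connected `k`-polymers: the polynomial diameter factor absorbed into
# the per-block constant, `(2(|X|_k + c))^{d/2} ≤ C_g·g^{|X|_k}`

`FluctuationKernelComparisonConnTorusFRD.tayNormLE_fluct_sub_fluct_conn_of_torusFRD` bounds
`‖(R_{q'} − R_q)F‖_{k:k+1,X}` for a connected `k`-polymer `X` by `b·((r₀+1)·8q_H·h_X)·κ^{|X|_k}` with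
`h_X = (3^{d+1}(2(|X|_k + 2(2^d+R) + 2p_Φ + 1))^d)^{1/2}·(T e^{2KT} K)` — a POLYNOMIAL in `|X|_k`.  The two-kernel comparison
of `S_k` (line `banach_two_kernel` of the child `TwoKernelSkBound` of the cruxes `HypACumulant` / `HypALocalTwoPoint`, route
`Summits/HubbardSuperconductivity/…/Theses/ComplexGFFStiffness`) consumes the pair property in the shape `C·ℓ·κ'^{|X|_k}`
(`LinearisedMapABKMKernelSub`, `…KernelOnly` files), so the polynomial is absorbed into the base: for any `g ≥ 0` and `C_g`
with `(3^{d+1}(2(m + 2(2^d+R) + 2p_Φ + 1))^d)^{1/2} ≤ C_g g^m` for all `m` (for `g > 1` such a `C_g` exists, `m^{d/2} g^{−m} → 0`):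

* **`tayNormLE_fluct_sub_fluct_conn_geom_of_torusFRD`** — `‖(R_{q'} − R_q)F‖_{k:k+1,X} ≤ b·((r₀+1)·8q_H·C_g·T e^{2KT}K)·(gκ)^{|X|_k}`.

With the Hölder pair of `AbkmTwoKernelHolderPair.exists_holderPair_weightIntConstRho_le_one_add_mul` (`κ ≤ (1+ε)A_𝒫'`) the
per-block constant is `(1+ε)g·A_𝒫'`, as close to `A_𝒫'` as the room of the package allows.  Everything is proved; no named fact.

## References
* S. Adams, S. Buchholz, R. Kotecký, S. Müller, arXiv:1910.13564, Lemma 8.4 (and p. 65), Lemma 12.6 (12.53)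
  [AdamsBuchholzKoteckyMuller2019].
* S. Buchholz, J. Funct. Anal. 275 (2018), Thm 4.5 [Buchholz2016].
-/

noncomputable section

namespace Literature.MathematicalPhysics.StatisticalMechanics.GradientRG

open scoped BigOperators
open Real Set Finset MeasureTheory
open Literature.MathematicalPhysics.StatisticalMechanics.GradientFRD
  (fourierCoeff cExt cExt_of_mem IsElliptic IsUnitSymm InShell iterDiff supNorm conv ellOp isElliptic_one)
open Literature.MathematicalPhysics.StatisticalMechanics.TorusPolymer (IsPolymer numBlocks thicken blocks)
open Literature.Barriers.CriticalPhenomena.LongRangePhi4.Polymer (IsConn)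
open Literature.MathematicalPhysics.QuantumFieldTheory

variable {d M : ℕ} [NeZero M]

section Package

variable {L N Mord R n ñ : ℕ} {θbar lam μ δ₁ δ₀ A𝒫 : ℝ}
    {𝒞 : Matrix (Fin d) (Fin d) ℝ → ℕ → (Fin d → ZMod M) → ℝ} {Mc : ℕ → ℝ}
    {Cα : (Fin d → ℕ) → ℕ → ℝ} {c C : ℝ} {Cℓ : ℕ → ℝ}

set_option maxHeartbeats 800000 in
/-- **[ABKM19] Lemma 8.4 (`ℓ = 1`), volume-uniform, connected `k`-polymers, geometric form of the constant** (module
docstring): data of `tayNormLE_fluct_sub_fluct_conn_of_torusFRD`, plus reals `g`, `C_g` with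
`(3^{d+1}(2(m + 2(2^d+R) + 2p_Φ + 1))^d)^{1/2} ≤ C_g g^m` for every `m : ℕ`.
[cite: AdamsBuchholzKoteckyMuller2019, Lemma 8.4] -/
theorem tayNormLE_fluct_sub_fluct_conn_geom_of_torusFRD
    (hd : 3 ≤ d) (hMord : 1 ≤ Mord) (hMR : Mord ≤ R) (hLodd : Odd L) (hL : 2 ^ (d + 3) + 16 * R ≤ L)
    (hM : M = L ^ N)
    (hθbar : 0 < θbar) (hlam : 0 < lam) (hn : 2 * Mord ≤ n) (hn2 : 2 ≤ n) (hnñ : n ≤ ñ)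
    (hgap : d + 1 ≤ 2 * (ñ - n))
    (hc : 0 < c) (hC1 : 0 ≤ Cℓ 1)
    (hallA : ∀ A : Matrix (Fin d) (Fin d) ℝ, IsElliptic (1 / 2 : ℝ) 2 A →
        (∀ k, 1 ≤ k → k ≤ N + 1 →
          ∑ x : Fin d → ZMod M, 𝒞 A k x = 0 ∧ ∀ x, 𝒞 A k (-x) = 𝒞 A k x) ∧
        (∀ k, 1 ≤ k → k ≤ N + 1 → ∀ φ : (Fin d → ZMod M) → ℝ, ∑ x, φ x = 0 →
          0 ≤ ∑ x, ∑ y, φ x * 𝒞 A k (x - y) * φ y) ∧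
        (∀ φ : (Fin d → ZMod M) → ℝ, ∑ x, φ x = 0 →
          ellOp A (conv (fun x => ∑ k ∈ Finset.Icc 1 (N + 1), 𝒞 A k x) φ) = φ) ∧
        (∀ k, 1 ≤ k → k ≤ N → Mc k ≤ 0 ∧
          ∀ x : Fin d → ZMod M, ((L : ℝ) ^ k) / 2 ≤ (supNorm x : ℝ) →
            𝒞 A k x = Mc k) ∧
        (∀ k, 1 ≤ k → k ≤ N + 1 → ∀ B : Matrix (Fin d) (Fin d) ℝ, IsUnitSymm B →
          (∃ ε : ℝ, 0 < ε ∧ ∀ x : Fin d → ZMod M,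
            ContDiffOn ℝ ⊤ (fun s : ℝ => 𝒞 (A + s • B) k x) (Set.Ioo (-ε) ε)) ∧
          ∀ α : Fin d → ℕ, ∑ i, α i ≤ n → ∀ ℓ : ℕ, ∀ x : Fin d → ZMod M,
            abs (iteratedDeriv ℓ (fun s : ℝ => iterDiff α (𝒞 (A + s • B) k) x) 0)
              ≤ Cα α ℓ / (L : ℝ) ^ ((k - 1) * (d - 2 + ∑ i, α i))) ∧
        (∀ k, 1 ≤ k → k ≤ N + 1 → ∀ j : ℕ, ∀ κ : Fin d → ZMod M, κ ≠ 0 → InShell L j κ →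
          (j < k →
            c / (L : ℝ) ^ (2 * (d + ñ) + 1) * (L : ℝ) ^ (2 * j)
                / (L : ℝ) ^ ((k - j) * (d - 1 + n)) ≤ (fourierCoeff (𝒞 A k) κ).re ∧
            ‖fourierCoeff (𝒞 A k) κ‖
              ≤ C * (L : ℝ) ^ (2 * (d + ñ) + 1) * (L : ℝ) ^ (2 * j)
                  / (L : ℝ) ^ ((k - j) * (d - 1 + n))) ∧
          (k ≤ j →
            c / (L : ℝ) ^ (2 * (d + ñ) + 1) * (L : ℝ) ^ (2 * k)
                ≤ (fourierCoeff (𝒞 A k) κ).re ∧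
            ‖fourierCoeff (𝒞 A k) κ‖ ≤ C * (L : ℝ) ^ (2 * k)) ∧
          ∀ B : Matrix (Fin d) (Fin d) ℝ, IsUnitSymm B → ∀ ℓ : ℕ, 1 ≤ ℓ →
            (j < k →
              ‖iteratedDeriv ℓ (fun s : ℝ => fourierCoeff (𝒞 (A + s • B) k) κ) 0‖
                ≤ Cℓ ℓ * (L : ℝ) ^ (2 * (d + ñ) + 1) * (L : ℝ) ^ (2 * j)
                    / (L : ℝ) ^ ((k - j) * (d - 1 + ñ))) ∧
            (k ≤ j →
              ‖iteratedDeriv ℓ (fun s : ℝ => fourierCoeff (𝒞 (A + s • B) k) κ) 0‖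
                ≤ Cℓ ℓ * (L : ℝ) ^ (2 * k))))
    (hB : AbkmWeightBounds L N Mord R n θbar lam μ δ₁ δ₀ A𝒫 (fun j => 𝒞 1 j)
      (abkmWeightData L N Mord R θbar (schedDelta δ₀ δ₁ N) fun j => 𝒞 1 j))
    {k : ℕ} (hkN : k + 1 ≤ N) {ρ : ℝ} (hρ0 : 0 ≤ ρ) (hρ : ρ < θbar)
    {T₀ : ℝ} (hT₀ : T₀ ≤ 1 / 2) (hKT₀ : shellRatioConst c (Cℓ 1) (L : ℝ) d ñ * T₀ ≤ Real.log (1 + ρ))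
    {q q' : Matrix (Fin d) (Fin d) ℝ} (hq : q.IsSymm) (hq' : q'.IsSymm)
    (hqT : ∑ i, ∑ j, |q i j| ≤ T₀) (hq'T : ∑ i, ∑ j, |q' i j| ≤ T₀)
    {p qH ρ'' : ℝ} (hpq : p.HolderConjugate qH) (hρ''0 : 0 ≤ ρ'') (hρ'' : ρ'' < θbar)
    (hpρ : p * (1 + ρ) ≤ 1 + ρ'')
    {pT r₀ : ℕ} {h A : ℝ} {X : Finset (Fin d → ZMod M)} (hX : IsPolymer (L ^ k) X) (hXc : IsConn X)
    {g Cg : ℝ}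
    (habs : ∀ m : ℕ, Real.sqrt ((3 : ℝ) ^ (d + 1) * ((2 * (m + 2 * (2 ^ d + R) + 2 * pT + 1) : ℕ) : ℝ) ^ d) ≤ Cg * g ^ m)
    {F : ((Fin d → ZMod M) → ℝ) → ℂ} {b : ℝ} (hb : 0 ≤ b) (hFd : ContDiff ℝ r₀ F)
    (hFloc : IsGaugeLocal ((abkmNormParams L N Mord R pT r₀ h θbar A (schedDelta δ₀ δ₁ N)
      fun j => 𝒞 1 j).gauge k X) F)
    (hF : TayNormLE ((abkmNormParams L N Mord R pT r₀ h θbar A (schedDelta δ₀ δ₁ N) fun j => 𝒞 1 j).gauge k X)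
      r₀ ((abkmWeightData L N Mord R θbar (schedDelta δ₀ δ₁ N) fun j => 𝒞 1 j).weight k X) F b) :
    TayNormLE ((abkmNormParams L N Mord R pT r₀ h θbar A (schedDelta δ₀ δ₁ N) fun j => 𝒞 1 j).gauge k X) r₀
      ((abkmWeightData L N Mord R θbar (schedDelta δ₀ δ₁ N) fun j => 𝒞 1 j).midWeight k X)
      (fluct (𝒞 ((1 : Matrix (Fin d) (Fin d) ℝ) + q') (k + 1)) F -
        fluct (𝒞 ((1 : Matrix (Fin d) (Fin d) ℝ) + q) (k + 1)) F)
      (b * ((r₀ + 1) * (8 * qH *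
          (Cg *
            ((∑ i, ∑ j, |(q' - q) i j|) *
              Real.exp (2 * shellRatioConst c (Cℓ 1) (L : ℝ) d ñ * ∑ i, ∑ j, |(q' - q) i j|) *
              shellRatioConst c (Cℓ 1) (L : ℝ) d ñ)))) *
        (g * weightIntConstRho θbar ρ'' (traceConst d Mord R lam (derivSum d n fun θ' _ => Cα θ' 0)) ^ (1 / p)) ^
          numBlocks (L ^ k) X) := by
  have hconn := tayNormLE_fluct_sub_fluct_conn_of_torusFRD hd hMord hMR hLodd hL hM hθbar hlam hn hn2 hnñ hgap hc hC1
    hallA hB hkN hρ0 hρ hT₀ hKT₀ hq hq' hqT hq'T hpq hρ''0 hρ'' hpρ hX hXc hb hFd hFloc hF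
    (pT := pT) (r₀ := r₀) (h := h) (A := A)
  refine hconn.mono ?_ (fun φ => ((abkmWeightData L N Mord R θbar (schedDelta δ₀ δ₁ N) fun j => 𝒞 1 j).midWeight_pos k X φ).le)
  set m := numBlocks (L ^ k) X with hm
  set W := weightIntConstRho θbar ρ'' (traceConst d Mord R lam (derivSum d n fun θ' _ => Cα θ' 0)) ^ (1 / p) with hW
  set E := (∑ i, ∑ j, |(q' - q) i j|) *
      Real.exp (2 * shellRatioConst c (Cℓ 1) (L : ℝ) d ñ * ∑ i, ∑ j, |(q' - q) i j|) *
      shellRatioConst c (Cℓ 1) (L : ℝ) d ñ with hE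
  have hK0 : 0 ≤ shellRatioConst c (Cℓ 1) (L : ℝ) d ñ := shellRatioConst_nonneg hc hC1 (Nat.cast_nonneg _) d ñ
  have hT0 : 0 ≤ ∑ i, ∑ j, |(q' - q) i j| := sum_nonneg fun _ _ => sum_nonneg fun _ _ => abs_nonneg _
  have hE0 : 0 ≤ E := by rw [hE]; positivity
  have hW0 : 0 ≤ W := by
    rw [hW]
    exact Real.rpow_nonneg (zero_le_one.trans (one_le_weightIntConstRho hθbar hρ''0 hρ''
      (traceConst_nonneg d Mord R hlam.le (derivSum_nonneg d n _)))) _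
  have hqH0 : 0 ≤ qH := le_of_lt (lt_trans one_pos hpq.symm.lt)
  have h1 := habs m
  -- `sqrt(…) · W^m ≤ Cg · (g W)^m`
  have hkey : Real.sqrt ((3 : ℝ) ^ (d + 1) * ((2 * (m + 2 * (2 ^ d + R) + 2 * pT + 1) : ℕ) : ℝ) ^ d) * E * W ^ m ≤
      Cg * E * (g * W) ^ m := by
    rw [mul_pow]
    have := mul_le_mul_of_nonneg_right (mul_le_mul_of_nonneg_right h1 hE0) (pow_nonneg hW0 m)
    calc Real.sqrt ((3 : ℝ) ^ (d + 1) * ((2 * (m + 2 * (2 ^ d + R) + 2 * pT + 1) : ℕ) : ℝ) ^ d) * E * W ^ m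
        ≤ Cg * g ^ m * E * W ^ m := this
      _ = Cg * E * (g ^ m * W ^ m) := by ring
  have h2 := mul_le_mul_of_nonneg_left hkey (by positivity : (0 : ℝ) ≤ b * ((r₀ + 1) * (8 * qH)))
  calc b * ((↑r₀ + 1) * (8 * qH * (Real.sqrt ((3 : ℝ) ^ (d + 1) * ((2 * (m + 2 * (2 ^ d + R) + 2 * pT + 1) : ℕ) : ℝ) ^ d) * E))) * W ^ m
      = b * ((r₀ + 1) * (8 * qH)) * (Real.sqrt ((3 : ℝ) ^ (d + 1) * ((2 * (m + 2 * (2 ^ d + R) + 2 * pT + 1) : ℕ) : ℝ) ^ d) * E * W ^ m) := by ring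
    _ ≤ b * ((r₀ + 1) * (8 * qH)) * (Cg * E * (g * W) ^ m) := h2
    _ = b * ((↑r₀ + 1) * (8 * qH * (Cg * E))) * (g * W) ^ m := by ring

end Package

end Literature.MathematicalPhysics.StatisticalMechanics.GradientRG

end
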